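import Mathlib.Analysis.Calculus.MeanValue
import Literature.Geometry.Lorentzian.CoordRicciJet
import HarnessLib

/-!
# The scalar curvature of metric components as a smooth function of their 2-jet

Fifth layer of the coordinate tensor calculus (`CoordCurvature.lean`, `CoordRicciJet.lean`).
`CoordRicciJet.lean` shows that the Ricci form `ricAt G x` of a field of metric components is a
universal `C^∞` function `ricciJet` of the point and the 2-jet `(G x, DG x, D²G x)`. Here:

* `MetricCoord.ricAt_comp_add_right` — **naturality of `Ric` under translations**:
  `Ric(G ∘ (· + a))(x) = Ric(G)(x + a)` (every ingredient — `♯`, the Koszul form, `Γ`, `DΓ` — is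
  built from `fderiv`, which commutes with translations, `fderiv_comp_add_right`);
* `MetricCoord.ricciJet_eq_ricciJet_zero` — hence **the Ricci jet function does not depend on
  the base point**: `ricciJet (y₀, A, D₁, D₂) = ricciJet (0, A, D₁, D₂)`;
* `MetricCoord.scalAt_eq_scalarJet` — **the scalar curvature is a jet function**:
  `S(G)(x) = tr ((G x)⁻¹ ∘ ricciJet (0, G x, DG x, D²G x))`, and `MetricCoord.contDiffOn_scalarJet`:
  that function of `(A, D₁, D₂)` is `C^∞` on the open set `{A invertible}`
  (`isOpen_scalarJetDomain`);
* `exists_bound_sub_le_mul_norm_sub_of_contDiffOn` — a `C¹` function on an open set is Lipschitz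
  on every compact convex subset (mean value inequality with the maximum of `‖Df‖`).

These are the tools for estimating the scalar curvature of an *affine* family of metric
components `G_s = H + s P` uniformly in `s`: `S(G_s)(y) − S(H)(y)` is the increment of a fixed
smooth jet function along the segment `J_H(y) + s J_P(y)` in jet space, hence bounded by
`|s| · M · ‖J_P(y)‖` as long as the segment stays in a fixed compact convex set of jets — the
mechanism behind the uniform decay `|R_t| ≤ C |t| r⁻⁴` of the scalar curvatures of Schoen–Yau's
metrics `ds² + t Ric` (Comm. Math. Phys. 65 (1979), pp. 72–74, (3.28)–(3.29)). All results are
proved; no definition of `Prop` type is introduced.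

## References

* B. O'Neill, *Semi-Riemannian geometry*, Academic Press 1983, Ch. 3, Lemma 3.52, Def. 3.53.
* R. Schoen, S.-T. Yau, Comm. Math. Phys. 65 (1979) 45–76, (3.28)–(3.29) (p. 73).
-/

noncomputable section

set_option maxSynthPendingDepth 3

open Set Filter Function Metric
open scoped Topology ContDiff

namespace Literature.Geometry.Lorentzian

namespace MetricCoord

variable {E : Type*} [NormedAddCommGroup E] [NormedSpace ℝ E]

/-! ### Naturality of the coordinate curvature under translations -/

section Translate

variable (G : E → E →L[ℝ] E →L[ℝ] ℝ) (a : E)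

/-- `♯` of translated components. [folklore] -/
theorem sharpAt_comp_add_right (x : E) : sharpAt (fun y ↦ G (y + a)) x = sharpAt G (x + a) := rfl

/-- The Koszul form of translated components. [folklore] -/
theorem koszulCLM_comp_add_right (x : E) :
    koszulCLM (fun y ↦ G (y + a)) x = koszulCLM G (x + a) := by
  unfold koszulCLM
  rw [fderiv_comp_add_right]

/-- The Christoffel map of translated components. [folklore] -/
theorem chrAt_comp_add_right : chrAt (fun y ↦ G (y + a)) = fun x ↦ chrAt G (x + a) := by
  funext x
  unfold chrAt
  rw [sharpAt_comp_add_right, koszulCLM_comp_add_right]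

/-- The curvature of translated components. [folklore] -/
theorem riemAt_comp_add_right (x X Y : E) :
    riemAt (fun y ↦ G (y + a)) x X Y = riemAt G (x + a) X Y := by
  unfold riemAt
  rw [chrAt_comp_add_right, fderiv_comp_add_right]

variable [FiniteDimensional ℝ E]

/-- **Naturality of the Ricci form under translations**: `Ric(G ∘ (· + a))(x) = Ric(G)(x + a)`.
[cite: ONeill1983, Ch. 3, Lemma 3.52] -/
theorem ricAt_comp_add_right (x : E) : ricAt (fun y ↦ G (y + a)) x = ricAt G (x + a) := by
  ext Y Z
  rw [ricAt_apply, ricAt_apply]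
  congr 1
  ext X
  simp only [ricciEndo_apply, riemAt_comp_add_right]

end Translate

/-! ### The Ricci jet function does not depend on the base point -/

/-- The Taylor field centred at `y₀` is the translate of the Taylor field centred at `0`.
[folklore] -/
theorem taylor2_eq_comp_add_neg (y₀ : E) (A : E →L[ℝ] E →L[ℝ] ℝ)
    (D₁ : E →L[ℝ] E →L[ℝ] E →L[ℝ] ℝ) (D₂ : E →L[ℝ] E →L[ℝ] E →L[ℝ] E →L[ℝ] ℝ) :
    taylor2 y₀ A D₁ D₂ = fun y ↦ taylor2 0 A D₁ D₂ (y + -y₀) := by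
  funext y
  simp only [taylor2, sub_zero, ← sub_eq_add_neg]

/-- **The Ricci jet function does not depend on the base point**:
`ricciJet (y₀, A, D₁, D₂) = ricciJet (0, A, D₁, D₂)`. [folklore] -/
theorem ricciJet_eq_ricciJet_zero [CompleteSpace E] [FiniteDimensional ℝ E] (y₀ : E)
    (A : E →L[ℝ] E →L[ℝ] ℝ) (D₁ : E →L[ℝ] E →L[ℝ] E →L[ℝ] ℝ)
    (D₂ : E →L[ℝ] E →L[ℝ] E →L[ℝ] E →L[ℝ] ℝ) :
    ricciJet (y₀, A, D₁, D₂) = ricciJet ((0 : E), A, D₁, D₂) := by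
  unfold ricciJet
  simp only
  rw [taylor2_eq_comp_add_neg y₀ A D₁ D₂, ricAt_comp_add_right, add_neg_cancel]

/-! ### The scalar curvature as a jet function -/

section ScalarJet

variable [CompleteSpace E] [FiniteDimensional ℝ E]

/-- **The scalar curvature is a function of the 2-jet**: for smooth nondegenerate components `G`
on `V` and `x ∈ V`, `S(G)(x) = tr ((G x)⁻¹ ∘ ricciJet (0, G x, DG x, D²G x))`
(`S = tr_G Ric`, `Ric = ricciJet` of the jet, base point irrelevant).
[cite: ONeill1983, Ch. 3, Def. 3.53] -/
theorem scalAt_eq_scalarJet {G : E → E →L[ℝ] E →L[ℝ] ℝ} {V : Set E} {x : E}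
    (hG : IsMetricOn G V) (hx : x ∈ V) :
    scalAt G x = traceCLM E ((G x).inverse.comp
      (ricciJet ((0 : E), G x, fderiv ℝ G x, fderiv ℝ (fderiv ℝ G) x))) := by
  unfold scalAt
  rw [mtrAt_eq_traceCLM, ricAt_eq_ricciJet hG hx, ricciJet_eq_ricciJet_zero]
  rfl

omit [FiniteDimensional ℝ E] in
/-- The domain `{A invertible}` of the scalar jet function is open. [folklore] -/
theorem isOpen_scalarJetDomain :
    IsOpen {q : (E →L[ℝ] E →L[ℝ] ℝ) × (E →L[ℝ] E →L[ℝ] E →L[ℝ] ℝ) ×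
      (E →L[ℝ] E →L[ℝ] E →L[ℝ] E →L[ℝ] ℝ) | q.1.IsInvertible} := by
  have hset : {q : (E →L[ℝ] E →L[ℝ] ℝ) × (E →L[ℝ] E →L[ℝ] E →L[ℝ] ℝ) ×
      (E →L[ℝ] E →L[ℝ] E →L[ℝ] E →L[ℝ] ℝ) | q.1.IsInvertible} = Prod.fst ⁻¹'
        (range ((↑) : (E ≃L[ℝ] (E →L[ℝ] ℝ)) → E →L[ℝ] E →L[ℝ] ℝ)) := by
    ext q
    simp only [mem_setOf_eq, mem_preimage, mem_range, ContinuousLinearMap.IsInvertible]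
  rw [hset]
  exact ContinuousLinearEquiv.isOpen.preimage continuous_fst

/-- **The scalar jet function `(A, D₁, D₂) ↦ tr (A⁻¹ ∘ ricciJet (0, A, D₁, D₂))` is `C^∞` on
`{A invertible}`** (inversion is smooth on invertible maps, `ricciJet` is smooth on its domain,
the trace is linear). [folklore] -/
theorem contDiffOn_scalarJet :
    ContDiffOn ℝ ∞ (fun q : (E →L[ℝ] E →L[ℝ] ℝ) × (E →L[ℝ] E →L[ℝ] E →L[ℝ] ℝ) ×
        (E →L[ℝ] E →L[ℝ] E →L[ℝ] E →L[ℝ] ℝ) ↦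
      traceCLM E (q.1.inverse.comp (ricciJet ((0 : E), q.1, q.2.1, q.2.2))))
      {q | q.1.IsInvertible} := by
  intro q hq
  have hι : ContDiff ℝ ∞ (fun q : (E →L[ℝ] E →L[ℝ] ℝ) × (E →L[ℝ] E →L[ℝ] E →L[ℝ] ℝ) ×
      (E →L[ℝ] E →L[ℝ] E →L[ℝ] E →L[ℝ] ℝ) ↦ (((0 : E), q.1, q.2.1, q.2.2) :
        E × (E →L[ℝ] E →L[ℝ] ℝ) × (E →L[ℝ] E →L[ℝ] E →L[ℝ] ℝ) ×
          (E →L[ℝ] E →L[ℝ] E →L[ℝ] E →L[ℝ] ℝ))) :=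
    contDiff_const.prodMk (contDiff_fst.prodMk ((contDiff_fst.comp contDiff_snd).prodMk
      (contDiff_snd.comp contDiff_snd)))
  have hric : ContDiffAt ℝ ∞ (fun q : (E →L[ℝ] E →L[ℝ] ℝ) × (E →L[ℝ] E →L[ℝ] E →L[ℝ] ℝ) ×
      (E →L[ℝ] E →L[ℝ] E →L[ℝ] E →L[ℝ] ℝ) ↦ ricciJet ((0 : E), q.1, q.2.1, q.2.2)) q := by
    have h := contDiffOn_ricciJet (E := E) ((0 : E), q.1, q.2.1, q.2.2) (by simpa using hq)
    exact (h.contDiffAt (isOpen_ricciJetDomain.mem_nhds (by simpa using hq))).comp q hι.contDiffAt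
  have hinv : ContDiffAt ℝ ∞ (fun q : (E →L[ℝ] E →L[ℝ] ℝ) × (E →L[ℝ] E →L[ℝ] E →L[ℝ] ℝ) ×
      (E →L[ℝ] E →L[ℝ] E →L[ℝ] E →L[ℝ] ℝ) ↦ q.1.inverse) q :=
    (ContinuousLinearMap.IsInvertible.contDiffAt_map_inverse hq).comp q contDiffAt_fst
  exact ((traceCLM E).contDiff.contDiffAt.comp q (hinv.clm_comp hric)).contDiffWithinAt

end ScalarJet

end MetricCoord

/-! ### A `C¹` function is Lipschitz on compact convex subsets of its domain -/

/-- **Mean value inequality with a uniform constant on a compact convex set**: if `f` is `C¹` on an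
open set `Ω` of a real normed space and `K ⊆ Ω` is compact and convex, there is `M ≥ 0` with
`‖f y − f x‖ ≤ M ‖y − x‖` for all `x, y ∈ K` (`M = max_K ‖Df‖`,
`Convex.norm_image_sub_le_of_norm_fderiv_le`). [folklore] -/
theorem exists_bound_sub_le_mul_norm_sub_of_contDiffOn {V : Type*} [NormedAddCommGroup V]
    [NormedSpace ℝ V] {W : Type*} [NormedAddCommGroup W] [NormedSpace ℝ W] {f : V → W}
    {Ω K : Set V} {n : WithTop ℕ∞} (hf : ContDiffOn ℝ n f Ω) (hn : 1 ≤ n) (hΩ : IsOpen Ω)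
    (hK : IsCompact K) (hKc : Convex ℝ K) (hKΩ : K ⊆ Ω) :
    ∃ M : ℝ, 0 ≤ M ∧ ∀ x ∈ K, ∀ y ∈ K, ‖f y - f x‖ ≤ M * ‖y - x‖ := by
  have hcont : ContinuousOn (fderiv ℝ f) Ω := hf.continuousOn_fderiv_of_isOpen hΩ hn
  obtain ⟨M₀, hM₀⟩ := hK.exists_bound_of_continuousOn (hcont.mono hKΩ)
  refine ⟨max M₀ 0, le_max_right _ _, fun x hx y hy ↦ ?_⟩
  refine hKc.norm_image_sub_le_of_norm_fderiv_le (fun z hz ↦ ?_)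
    (fun z hz ↦ (hM₀ z hz).trans (le_max_left _ _)) hx hy
  exact (hf.differentiableOn (by positivity) z (hKΩ hz)).differentiableAt (hΩ.mem_nhds (hKΩ hz))

end Literature.Geometry.Lorentzian

end
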